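import Mathlib

/-!
# Stub `stub_smoothLimit` of line `Sketch` for crux `TameOrBrodyR4` (stmt-SmoothPoincare4-7826, route SullivanDual)

Smooth limits under locally uniform bounds on all derivatives: if `C^∞` maps `u n : ℂ → ℝ⁴`
converge locally uniformly to `v` and, for every order `k` and radius `r`, `‖D^k (u n)‖` is
bounded on `closedBall 0 r` uniformly in `n`, then `v` is `C^∞` and `d(u n) → dv` locally
uniformly, along the whole sequence (no further subsequence). Proof:

* Landau–Kolmogorov interpolation (`SmoothLimit.norm_fderiv_le`): a `C²` map `f` with
  `‖D²f‖ ≤ M` and `‖f‖ ≤ δ` on `closedBall z ε` has `‖df(z)‖ ≤ 2δ/ε + Mε` (first-order Taylor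
  estimate `Convex.norm_image_sub_le_of_norm_fderiv_le'` on the ball, tested on `z + ε • e`,
  `‖e‖ = 1`);
* applied to `u m - u n` on `closedBall 0 (r + 1)` it makes `d(u n)` uniformly Cauchy on
  `closedBall 0 r` (`SmoothLimit.uniformCauchySeqOn_fderiv`); completeness gives a locally uniform
  limit of `d(u n)`, which is `dv` by `hasFDerivAt_of_tendstoLocallyUniformlyOn`
  (`SmoothLimit.differentiable_lim`);
* induction on the order `k`, over all complete real normed targets at once: the sequence of
  derivatives `d(u n) → dv` satisfies the same hypotheses (`‖D^j d(u n)‖ = ‖D^{j+1} (u n)‖`,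
  `norm_iteratedFDeriv_fderiv`), so `contDiff_succ_iff_fderiv` gives `ContDiff ℝ k v` for every
  `k : ℕ` (`SmoothLimit.contDiff_lim`), i.e. `ContDiff ℝ ∞ v` (`contDiff_infty`).

Folklore (real analysis; the interpolation inequality goes back to Landau 1913).
-/

noncomputable section

open scoped ContDiff Topology
open Filter Set Metric

-- the registered namespace `Summit.SmoothPoincare4.SmoothPoincare4.…` repeats a component
set_option linter.dupNamespace false

namespace Summit.SmoothPoincare4.SmoothPoincare4.Cruxes.TameOrBrodyR4.Sketch

/-- Local notation for the model space `ℝ⁴ = EuclideanSpace ℝ (Fin 4)`. -/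
local notation "E4" => EuclideanSpace ℝ (Fin 4)

namespace SmoothLimit

universe u

variable {E F : Type*} [NormedAddCommGroup E] [NormedSpace ℝ E]
  [NormedAddCommGroup F] [NormedSpace ℝ F]

/-- **Landau–Kolmogorov interpolation.** For a `C²` map `f` with `‖D²f‖ ≤ M` and `‖f‖ ≤ δ` on the
closed ball of radius `ε > 0` about `z`: `‖df(z)‖ ≤ 2δ/ε + Mε`. -/
theorem norm_fderiv_le {f : E → F} (hf : ContDiff ℝ 2 f) {z : E} {ε M δ : ℝ} (hε : 0 < ε)
    (hM : ∀ x ∈ closedBall z ε, ‖iteratedFDeriv ℝ 2 f x‖ ≤ M)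
    (hδ : ∀ x ∈ closedBall z ε, ‖f x‖ ≤ δ) :
    ‖fderiv ℝ f z‖ ≤ 2 * δ / ε + M * ε := by
  have hd : Differentiable ℝ f := hf.differentiable (by simp)
  have hd' : Differentiable ℝ (fderiv ℝ f) :=
    (hf.fderiv_right (m := 1) (by norm_num)).differentiable (by simp)
  have hz : z ∈ closedBall z ε := mem_closedBall_self hε.le
  have h0M : 0 ≤ M := (norm_nonneg _).trans (hM z hz)
  have h0δ : 0 ≤ δ := (norm_nonneg _).trans (hδ z hz)
  -- `‖D(Df)‖ = ‖D²f‖` (curried vs. uncurried second derivative)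
  have hM' : ∀ x ∈ closedBall z ε, ‖fderiv ℝ (fderiv ℝ f) x‖ ≤ M := fun x hx => by
    rw [← norm_iteratedFDeriv_one (𝕜 := ℝ), norm_iteratedFDeriv_fderiv]; exact hM x hx
  -- on the ball the derivative is `M ε`-close to its value at the centre
  have h1 : ∀ x ∈ closedBall z ε, ‖fderiv ℝ f x - fderiv ℝ f z‖ ≤ M * ε := by
    intro x hx
    calc ‖fderiv ℝ f x - fderiv ℝ f z‖ ≤ M * ‖x - z‖ :=
          (convex_closedBall z ε).norm_image_sub_le_of_norm_fderiv_le (fun y _ => hd' y) hM' hz hx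
      _ ≤ M * ε := by gcongr; exact mem_closedBall_iff_norm.mp hx
  -- first-order Taylor estimate on the ball
  have h2 : ∀ x ∈ closedBall z ε, ‖f x - f z - fderiv ℝ f z (x - z)‖ ≤ M * ε * ε := by
    intro x hx
    calc ‖f x - f z - fderiv ℝ f z (x - z)‖ ≤ M * ε * ‖x - z‖ :=
          (convex_closedBall z ε).norm_image_sub_le_of_norm_fderiv_le' (fun y _ => hd y) h1 hz hx
      _ ≤ M * ε * ε := by gcongr; exact mem_closedBall_iff_norm.mp hx
  refine ContinuousLinearMap.opNorm_le_of_unit_norm (by positivity) fun e he => ?_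
  have hx : z + ε • e ∈ closedBall z ε := by
    rw [mem_closedBall_iff_norm, add_sub_cancel_left, norm_smul, he, mul_one,
      Real.norm_of_nonneg hε.le]
  have h3 := h2 _ hx
  rw [add_sub_cancel_left, map_smul] at h3
  have h4 : ε * ‖fderiv ℝ f z e‖ ≤ 2 * δ + M * ε * ε := by
    have h5 : ‖ε • fderiv ℝ f z e‖ ≤
        ‖f (z + ε • e)‖ + ‖f z‖ + ‖f (z + ε • e) - f z - ε • fderiv ℝ f z e‖ :=
      calc ‖ε • fderiv ℝ f z e‖
            = ‖(f (z + ε • e) - f z) - (f (z + ε • e) - f z - ε • fderiv ℝ f z e)‖ := by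
              congr 1; abel
        _ ≤ ‖f (z + ε • e) - f z‖ + ‖f (z + ε • e) - f z - ε • fderiv ℝ f z e‖ :=
              norm_sub_le _ _
        _ ≤ ‖f (z + ε • e)‖ + ‖f z‖ + ‖f (z + ε • e) - f z - ε • fderiv ℝ f z e‖ := by
              gcongr; exact norm_sub_le _ _
    rw [norm_smul, Real.norm_of_nonneg hε.le] at h5
    linarith [hδ _ hx, hδ z hz]
  rw [div_add' _ _ _ hε.ne', le_div_iff₀ hε]
  linarith

/-- Derivatives of a locally uniformly convergent sequence of smooth maps on `ℂ` whose second
derivatives are bounded on every disc, uniformly along the sequence, are uniformly Cauchy on every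
closed disc. -/
theorem uniformCauchySeqOn_fderiv {u : ℕ → ℂ → F} {v : ℂ → F} (hu : ∀ n, ContDiff ℝ ∞ (u n))
    (hb : ∀ r : ℝ, ∃ C : ℝ, ∀ n, ∀ z ∈ closedBall (0 : ℂ) r, ‖iteratedFDeriv ℝ 2 (u n) z‖ ≤ C)
    (hlim : TendstoLocallyUniformly u v atTop) (r : ℝ) :
    UniformCauchySeqOn (fun n => fderiv ℝ (u n)) atTop (closedBall (0 : ℂ) r) := by
  obtain ⟨C, hC⟩ := hb (r + 1)
  obtain ⟨M, h0M, hCM⟩ : ∃ M : ℝ, 0 ≤ M ∧ C ≤ M := ⟨max C 0, le_max_right _ _, le_max_left _ _⟩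
  have hU : UniformCauchySeqOn u atTop (closedBall (0 : ℂ) (r + 1)) :=
    (tendstoLocallyUniformly_iff_forall_isCompact.mp hlim _
      (isCompact_closedBall _ _)).uniformCauchySeqOn
  rw [Metric.uniformCauchySeqOn_iff] at hU ⊢
  intro η hη
  -- the interpolation radius `ε` and the sup-distance `η ε / 8`
  have hK : (0 : ℝ) < 4 * M + 1 := by positivity
  obtain ⟨ε, hε, hε1, hMε⟩ : ∃ ε : ℝ, 0 < ε ∧ ε ≤ 1 ∧ 2 * M * ε ≤ η / 2 := by
    refine ⟨min 1 (η / (4 * M + 1)), lt_min one_pos (div_pos hη hK), min_le_left _ _, ?_⟩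
    have h12 : 2 * M / (4 * M + 1) ≤ 1 / 2 := by rw [div_le_iff₀ hK]; linarith
    calc 2 * M * min 1 (η / (4 * M + 1))
          ≤ 2 * M * (η / (4 * M + 1)) := by gcongr; exact min_le_right _ _
      _ = 2 * M / (4 * M + 1) * η := by ring
      _ ≤ 1 / 2 * η := mul_le_mul_of_nonneg_right h12 hη.le
      _ = η / 2 := by ring
  obtain ⟨N, hN⟩ := hU (η * ε / 8) (by positivity)
  refine ⟨N, fun m hm n hn z hz => ?_⟩
  have hd : ∀ k x, DifferentiableAt ℝ (u k) x := fun k x => ((hu k).differentiable (by simp)) x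
  have hsub : closedBall z ε ⊆ closedBall (0 : ℂ) (r + 1) :=
    closedBall_subset_closedBall' (by linarith [mem_closedBall.mp hz])
  have h2 : ContDiff ℝ 2 (u m - u n) := ((hu m).sub (hu n)).of_le (WithTop.coe_le_coe.mpr le_top)
  have hMb : ∀ x ∈ closedBall z ε, ‖iteratedFDeriv ℝ 2 (u m - u n) x‖ ≤ M + M := by
    intro x hx
    rw [iteratedFDeriv_sub_apply ((hu m).of_le (WithTop.coe_le_coe.mpr le_top)).contDiffAt
      ((hu n).of_le (WithTop.coe_le_coe.mpr le_top)).contDiffAt]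
    exact (norm_sub_le _ _).trans
      (add_le_add ((hC m x (hsub hx)).trans hCM) ((hC n x (hsub hx)).trans hCM))
  have hδb : ∀ x ∈ closedBall z ε, ‖(u m - u n) x‖ ≤ η * ε / 8 := fun x hx => by
    simpa only [Pi.sub_apply, ← dist_eq_norm] using (hN m hm n hn x (hsub hx)).le
  change dist (fderiv ℝ (u m) z) (fderiv ℝ (u n) z) < η
  rw [dist_eq_norm, ← fderiv_sub (hd m z) (hd n z)]
  calc ‖fderiv ℝ (u m - u n) z‖ ≤ 2 * (η * ε / 8) / ε + (M + M) * ε :=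
        norm_fderiv_le h2 hε hMb hδb
    _ = η / 4 + 2 * M * ε := by field_simp; ring
    _ < η := by linarith

/-- Under the hypotheses of `uniformCauchySeqOn_fderiv` (with a complete target), the limit `v` is
differentiable and `d(u n) → dv` locally uniformly. -/
theorem differentiable_lim [CompleteSpace F] {u : ℕ → ℂ → F} {v : ℂ → F}
    (hu : ∀ n, ContDiff ℝ ∞ (u n))
    (hb : ∀ r : ℝ, ∃ C : ℝ, ∀ n, ∀ z ∈ closedBall (0 : ℂ) r, ‖iteratedFDeriv ℝ 2 (u n) z‖ ≤ C)
    (hlim : TendstoLocallyUniformly u v atTop) :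
    Differentiable ℝ v ∧
      TendstoLocallyUniformly (fun n => fderiv ℝ (u n)) (fderiv ℝ v) atTop := by
  have hU := uniformCauchySeqOn_fderiv hu hb hlim
  -- pointwise limits of the derivatives
  set G : ℂ → ℂ →L[ℝ] F := fun z => limUnder atTop fun n => fderiv ℝ (u n) z with hG
  have hpt : ∀ z, Tendsto (fun n => fderiv ℝ (u n) z) atTop (𝓝 (G z)) := fun z =>
    ((hU ‖z‖).cauchySeq (mem_closedBall_zero_iff.mpr le_rfl)).tendsto_limUnder
  have hGl : TendstoLocallyUniformly (fun n => fderiv ℝ (u n)) G atTop := by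
    refine tendstoLocallyUniformly_iff_forall_isCompact.mpr fun K hK => ?_
    obtain ⟨r, hr⟩ := hK.isBounded.subset_closedBall 0
    exact ((hU r).tendstoUniformlyOn_of_tendsto fun z _ => hpt z).mono hr
  have hderiv : ∀ z, HasFDerivAt v (G z) z := fun z =>
    hasFDerivAt_of_tendstoLocallyUniformlyOn isOpen_univ hGl.tendstoLocallyUniformlyOn
      (fun n x _ => (((hu n).differentiable (by simp)) x).hasFDerivAt)
      (fun x _ => hlim.tendstoLocallyUniformlyOn.tendsto_at (mem_univ x)) (mem_univ z)
  have hfd : fderiv ℝ v = G := funext fun z => (hderiv z).fderiv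
  exact ⟨fun z => (hderiv z).differentiableAt, hfd ▸ hGl⟩

/-- Smoothness of the limit of every finite order, by induction on the order simultaneously for
all complete targets (the induction step passes to the sequence of derivatives). -/
theorem contDiff_lim (k : ℕ) :
    ∀ {G : Type u} [NormedAddCommGroup G] [NormedSpace ℝ G] [CompleteSpace G]
      {u : ℕ → ℂ → G} {v : ℂ → G}, (∀ n, ContDiff ℝ ∞ (u n)) →
      (∀ (j : ℕ) (r : ℝ), ∃ C : ℝ, ∀ n, ∀ z ∈ closedBall (0 : ℂ) r,
        ‖iteratedFDeriv ℝ j (u n) z‖ ≤ C) →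
      TendstoLocallyUniformly u v atTop → ContDiff ℝ k v := by
  induction k with
  | zero =>
    intro G _ _ _ u v hu hb hlim
    exact_mod_cast contDiff_zero.2
      (hlim.continuous (Eventually.of_forall fun n => (hu n).continuous).frequently)
  | succ k ih =>
    intro G _ _ _ u v hu hb hlim
    obtain ⟨hdiff, hder⟩ := differentiable_lim hu (hb 2) hlim
    have hb' : ∀ (j : ℕ) (r : ℝ), ∃ C : ℝ, ∀ n, ∀ z ∈ closedBall (0 : ℂ) r,
        ‖iteratedFDeriv ℝ j (fderiv ℝ (u n)) z‖ ≤ C := fun j r => by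
      obtain ⟨C, hC⟩ := hb (j + 1) r
      exact ⟨C, fun n z hz => by rw [norm_iteratedFDeriv_fderiv]; exact hC n z hz⟩
    have hk : ContDiff ℝ k (fderiv ℝ v) :=
      ih (fun n => (contDiff_infty_iff_fderiv.1 (hu n)).2) hb' hder
    push_cast
    exact contDiff_succ_iff_fderiv.2 ⟨hdiff, fun h => absurd h (WithTop.natCast_ne_top k), hk⟩

end SmoothLimit

/-- **Smooth limits under locally uniform bounds on all derivatives.** If `C^∞` maps
`u n : ℂ → ℝ⁴` converge locally uniformly to `v` and, for every order `k` and radius `r`,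
`‖D^k (u n)‖` is bounded on `closedBall 0 r` uniformly in `n`, then `v` is `C^∞` and
`d(u n) → dv` locally uniformly (along the whole sequence). -/
theorem stub_smoothLimit (u : ℕ → ℂ → E4) (v : ℂ → E4) (hu : ∀ n, ContDiff ℝ ∞ (u n))
    (hb : ∀ (k : ℕ) (r : ℝ), ∃ C : ℝ, ∀ n, ∀ z ∈ Metric.closedBall (0 : ℂ) r,
      ‖iteratedFDeriv ℝ k (u n) z‖ ≤ C)
    (hlim : TendstoLocallyUniformly u v atTop) :
    ContDiff ℝ ∞ v ∧ TendstoLocallyUniformly (fun n => fderiv ℝ (u n)) (fderiv ℝ v) atTop := by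
  exact ⟨contDiff_infty.2 fun k => SmoothLimit.contDiff_lim k hu hb hlim,
    (SmoothLimit.differentiable_lim hu (hb 2) hlim).2⟩

end Summit.SmoothPoincare4.SmoothPoincare4.Cruxes.TameOrBrodyR4.Sketch
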